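import Summits.ResolutionOfSingularities.ResolutionOfSingularities.Theorems.HilbertSamuelEliminationSigmaMaxModificationsCorridor3WLadderE1NearStep
import Summits.ResolutionOfSingularities.ResolutionOfSingularities.Theorems.HilbertSamuelEliminationSigmaMaxModificationsCorridor3WLadderIsoTailsFreeRationalLow
import Summits.ResolutionOfSingularities.ResolutionOfSingularities.Theorems.HilbertSamuelEliminationSigmaMaxModificationsCorridor3WLadderIsoTailsFreeRationalTower
import HarnessLib

/-!
# [OURS · L1 W4.2] The `e = 1` door through the arc, step 3b/3 — **an `e = 1` near-point tower out of an ISOLATED HYPERSURFACE stage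
# over a maximal origin is impossible** (crux `SigmaMaxModifications` stmt-ResolutionOfSingularities-18506 / conjunct stmt-…-19249,
# line `w_ladder`, row `stub_Wlow3M_two` (β) — the `e = 1` third door / CJS Cor. 6.37's role; `--supports 19249`, helper)

Stub worker res-L1-w42-stub-3 (gen 5). Sorry-free PROOF file, no definition, no named fact. OURS bookkeeping for the W4.2 crux chain
(cell res-hironaka); NOT a statement of [Hironaka2017] nor of [CossartJannsenSaito2020]. AI-written; AI review is weaker than expert review.

**`E1Free.false_of_e1PointTower_of_hypersurfaceStage`.** DATA: a point tower `(T, pt)` at level `3` over a maximal origin of characteristic `p`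
(`C_n = {x_n}` closed, `π_n x_{n+1} = x_n`, `H^3(x_n) = ν`), with `x_0` ISOLATED in `(X_0)_max`, every `x_n` of directrix dimension
`e = 1` and every `x_{n+1}` on `ℙ(Dir x_n)` (so: an infinite CJS fundamental sequence over `x_0`, Def. 6.34 with `e = 1`, read on the
global stages), and `𝒪_{X_0,x_0}` a HYPERSURFACE SINGULARITY of embedding dimension `4` and multiplicity `m ≥ 2` (`σ : R ↠ 𝒪`, `R` regular
local with `CharP R p`, `ker σ = (h)`, `h ∈ 𝔪^m ∖ 𝔪^{m+1}`). CONCLUSION: `False`. PROOF: by induction along the tower the hypersurface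
presentation with a TRANSVERSAL exceptional slot propagates (`exists_presentation_step`, started at a transversal slot found by the
tree's `exists_linForm_notMem_directrixSpace`); hence every step is RATIONAL (`projDir_line`) and NOT A SATELLITE step (res-type-071's
dictionary `not_isSatelliteStep_iff_forall_dvd_of_eq`), and the grade-free H∞-FINAL
(`IsoTailsHS.false_of_pointTower_of_freeRationalTail_of_hypersurfaceStage`, p535876) closes. This is CJS Cor. 6.37 (`e = 1`, isolated)
in the HYPERSURFACE CELL, for the global point towers of the W-ladder, from the tree alone (no named fact).

[OURS · L1 W4.2; AI-written] [cite: CossartJannsenSaito2020, Def. 6.34, Cor. 6.37, Thm. 9.3] [cite: CossartPiltant2009, ch. 3 I.9]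
-/

set_option linter.dupNamespace false

noncomputable section

open CategoryTheory AlgebraicGeometry TopologicalSpace IsLocalRing MvPolynomial Module
open Literature.RingTheory.MvPolynomial Literature.RingTheory.HilbertSamuel Literature.AlgebraicGeometry.Resolution
open Literature.AlgebraicGeometry.CossartJannsenSaito2020
open Scheme.IdealSheafData
open Summit.ResolutionOfSingularities.ResolutionOfSingularities.Theorems.CampaignW42
open Summit.ResolutionOfSingularities.ResolutionOfSingularities.Theorems.SigmaMaxModificationsCorridor3.Helpers
open Summit.ResolutionOfSingularities.ResolutionOfSingularities.Cruxes.SigmaMaxModifications.IdeasL1C5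
open Summit.ResolutionOfSingularities.ResolutionOfSingularities.Cruxes.SigmaMaxModifications.IdeasL1C4

namespace Summit.ResolutionOfSingularities.ResolutionOfSingularities.Theorems.SigmaMaxModificationsCorridor3.E1Free

universe u

/-! ## The step with the base point named (`π x′ = x` as an equation) -/

/-- `(stalkCongr rfl).inv` is the identity. [folklore] -/
theorem stalkCongr_inv_self_apply {Y : Scheme.{u}} (x : Y) (a : Y.presheaf.stalk x) :
    (Y.presheaf.stalkCongr (.of_eq (rfl : x = x))).inv a = a := by
  rw [TopCat.Presheaf.stalkCongr_inv]
  exact stalkSpecializes_self_apply _ _ _ a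

/-- Transport of `𝔪` along `stalkCongr` of an equation of points. [folklore] -/
theorem stalkCongr_inv_mem_maximalIdeal {Y : Scheme.{u}} {x x' : Y} (h : x' = x) {a : Y.presheaf.stalk x}
    (ha : a ∈ maximalIdeal (Y.presheaf.stalk x)) :
    (Y.presheaf.stalkCongr (.of_eq h)).inv a ∈ maximalIdeal (Y.presheaf.stalk x') := by
  subst h
  rwa [stalkCongr_inv_self_apply]

/-- **`exists_presentation_step` with the base point named** (`π x′ = x` as an equation; compatibilities through Mathlib's `stalkCongr`,
as in res-type-071's `_of_eq` sockets). [OURS · L1 W4.2; AI-written] [cite: CossartJannsenSaito2020, Def. 6.34 (i), Thm. 9.3] -/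
theorem exists_presentation_step_of_eq {Y Y' : Scheme.{u}} [IsLocallyNoetherian Y] [IsLocallyNoetherian Y'] {π : Y' ⟶ Y}
    {D : Y.IdealSheafData} (hπ : IsBlowup π D) (x' : Y') (x : Y) (hx : π x' = x)
    (hD : stalkIdeal D x = maximalIdeal (Y.presheaf.stalk x))
    (hcl : IsClosed ({x} : Set Y)) (hπpt : IsBlowup π (vanishingIdeal ⟨{x}, hcl⟩))
    {R : Type u} [CommRing R] [IsRegularLocalRing R] {d : ℕ} (hd : (maximalIdeal R).spanFinrank = d)
    (c : Fin d → R) (hc : Ideal.span (Set.range c) = maximalIdeal R)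
    (σ : R →+* Y.presheaf.stalk x) (hσ : Function.Surjective σ) {h : R}
    (hker : RingHom.ker σ = Ideal.span {h}) {m : ℕ} (hm2 : 2 ≤ m) (hm : h ∈ maximalIdeal R ^ m)
    (hm' : h ∉ maximalIdeal R ^ (m + 1)) (j₀ : Fin d)
    (he : Scheme.dirDim Y x = 1) (hon : IsOnProjDirectrix π x')
    (hHS : hilbertSamuelFun (Y'.presheaf.stalk x') 0 = hilbertSamuelFun (Y.presheaf.stalk x) 0)
    (he' : 1 ≤ Scheme.dirDim Y' x')
    (htrans : (X j₀ : MvPolynomial (Fin d) (ResidueField (Y.presheaf.stalk x))) ∉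
      directrixSpace (tangentConeIdeal (σ ∘ c) (span_range_comp_eq_maximalIdeal hc σ hσ))) :
    ∃ (R' : Type u) (_ : CommRing R') (_ : IsRegularLocalRing R') (y' : Fin d → R') (σ' : R' →+* Y'.presheaf.stalk x')
      (h' : R') (hy' : Ideal.span (Set.range y') = maximalIdeal R') (hσ' : Function.Surjective σ'),
      (maximalIdeal R').spanFinrank = d ∧ RingHom.ker σ' = Ideal.span {h'} ∧
      h' ∈ maximalIdeal R' ^ m ∧ h' ∉ maximalIdeal R' ^ (m + 1) ∧
      σ' (y' j₀) = (π.stalkMap x').hom ((Y.presheaf.stalkCongr (.of_eq hx)).inv (σ (c j₀))) ∧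
      (maximalIdeal (Y.presheaf.stalk (π x'))).map (π.stalkMap x').hom =
        Ideal.span {(π.stalkMap x').hom ((Y.presheaf.stalkCongr (.of_eq hx)).inv (σ (c j₀)))} ∧
      (X j₀ : MvPolynomial (Fin d) (ResidueField (Y'.presheaf.stalk x'))) ∉
        directrixSpace (tangentConeIdeal (σ' ∘ y') (span_range_comp_eq_maximalIdeal hy' σ' hσ')) := by
  subst hx
  have hid : ∀ a : Y.presheaf.stalk (π x'), (Y.presheaf.stalkCongr (.of_eq (rfl : π x' = π x'))).inv a = a :=
    stalkCongr_inv_self_apply (π x')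
  simp only [hid]
  exact exists_presentation_step hπ x' hD hcl hπpt hd c hc σ hσ hker hm2 hm hm' j₀ he hon hHS he' htrans

/-! ## The tower theorem -/

/-- **AN `e = 1` NEAR-POINT TOWER OUT OF AN ISOLATED HYPERSURFACE STAGE OVER A MAXIMAL ORIGIN IS IMPOSSIBLE** (module docstring):
CJS Cor. 6.37's infinite fundamental sequence (`e = 1`, isolated start), read on global point towers, in the HYPERSURFACE CELL, from the
tree alone. [OURS · L1 W4.2; AI-written] [cite: CossartJannsenSaito2020, Def. 6.34, Cor. 6.37, Thm. 9.3] [cite: CossartPiltant2009, ch. 3 I.9] -/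
theorem false_of_e1PointTower_of_hypersurfaceStage {p : ℕ} [Fact p.Prime] {ν : ℕ → ℕ} {T : BlowupTower.{u}}
    {pt : ∀ n, T.X n} (hC : ∀ n, T.C n = {pt n}) (hπ : ∀ n, (T.π n).base (pt (n + 1)) = pt n)
    (hcl : ∀ n, IsClosed ({pt n} : Set (T.X n))) (hν : ∀ n, Scheme.hsFun (T.X n) 3 (pt n) = ν)
    (h0 : IsMaximalOrigin p 3 ν (T.X 0) (pt 0))
    (hiso : @IsIsolatedInHSMaxLocus (T.X 0) (T.ln 0) 3 (pt 0))
    (he1 : ∀ n, @Scheme.dirDim (T.X n) (T.ln n) (pt n) = 1)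
    (hon : ∀ n, @IsOnProjDirectrix (T.X (n + 1)) (T.X n) (T.ln n) (T.π n) (pt (n + 1)))
    {R : Type u} [CommRing R] [IsRegularLocalRing R] [CharP R p] (hd : (maximalIdeal R).spanFinrank = 4)
    (c : Fin 4 → R) (hc : Ideal.span (Set.range c) = maximalIdeal R)
    (σ : R →+* (T.X 0).presheaf.stalk (pt 0)) (hσ : Function.Surjective σ) {h : R}
    (hker : RingHom.ker σ = Ideal.span {h}) {m : ℕ} (hm2 : 2 ≤ m) (hm : h ∈ maximalIdeal R ^ m)
    (hm' : h ∉ maximalIdeal R ^ (m + 1)) : False := by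
  classical
  haveI : ∀ n, IsLocallyNoetherian (T.X n) := T.ln
  -- blow-ups of the reduced marked points, centre ideals, excellence, `H^{(0)}` constant
  have hblow : ∀ n, IsBlowup (T.π n) (vanishingIdeal ⟨{pt n}, hcl n⟩) :=
    IsoTailsHS.isBlowup_singleton_of_pointTower hC hcl
  have hexc : Scheme.IsExcellent (T.X 0) := isExcellent_of_isMaximalOrigin h0
  have hHS : ∀ n, hilbertSamuelFun ((T.X (n + 1)).presheaf.stalk (pt (n + 1))) 0 =
      hilbertSamuelFun ((T.X n).presheaf.stalk (pt n)) 0 := fun n =>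
    (IsoTailsHS.hilbertSamuelFun_stalk_eq_of_tower hexc h0.dim_le hπ hcl hν (n + 1) 0).trans
      (IsoTailsHS.hilbertSamuelFun_stalk_eq_of_tower hexc h0.dim_le hπ hcl hν n 0).symm
  -- a transversal slot at stage `0`
  have hd1 : 1 ≤ 4 := by norm_num
  have hxA : Ideal.span (Set.range (σ ∘ c)) = maximalIdeal ((T.X 0).presheaf.stalk (pt 0)) :=
    span_range_comp_eq_maximalIdeal hc σ hσ
  have hdA : (maximalIdeal ((T.X 0).presheaf.stalk (pt 0))).spanFinrank = 4 :=
    spanFinrank_maximalIdeal_eq_of_presentation hd σ hσ hker hm2 hm hm' hd1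
  have he0 : directrixDim (tangentConeIdeal (σ ∘ c) hxA) = 1 := by
    rw [← dirDim_eq' ((T.X 0).presheaf.stalk (pt 0)) hdA (σ ∘ c) hxA]; exact he1 0
  obtain ⟨j₀, hj₀⟩ := exists_linForm_notMem_directrixSpace hxA hdA (by rw [he0]; exact Nat.one_pos) hxA
    (fun l i => if i = l then (1 : (T.X 0).presheaf.stalk (pt 0)) else 0) (fun l => by
      rw [Finset.sum_eq_single l (fun i _ hi => by rw [if_neg hi, zero_mul]) (fun h => absurd (Finset.mem_univ l) h),
        if_pos rfl, one_mul])
  have htrans0 : (X j₀ : MvPolynomial (Fin 4) (ResidueField ((T.X 0).presheaf.stalk (pt 0)))) ∉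
      directrixSpace (tangentConeIdeal (σ ∘ c) hxA) := by
    have hfun : (fun i => residue ((T.X 0).presheaf.stalk (pt 0)) (if i = j₀ then (1 : (T.X 0).presheaf.stalk (pt 0)) else 0)) =
        Pi.single j₀ 1 := by
      funext i
      by_cases hi : i = j₀
      · subst hi; rw [if_pos rfl, map_one, Pi.single_eq_same]
      · rw [if_neg hi, map_zero, Pi.single_eq_of_ne hi]
    rw [hfun, linForm_single] at hj₀
    exact hj₀
  -- THE INDUCTION: a transversal hypersurface presentation at every stage
  have P : ∀ n, ∃ (R' : Type u) (_ : CommRing R') (_ : IsRegularLocalRing R') (y : Fin 4 → R')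
      (τ : R' →+* (T.X n).presheaf.stalk (pt n)) (g : R') (hy : Ideal.span (Set.range y) = maximalIdeal R')
      (hτ : Function.Surjective τ),
      (maximalIdeal R').spanFinrank = 4 ∧ RingHom.ker τ = Ideal.span {g} ∧ g ∈ maximalIdeal R' ^ m ∧ g ∉ maximalIdeal R' ^ (m + 1) ∧
      (X j₀ : MvPolynomial (Fin 4) (ResidueField ((T.X n).presheaf.stalk (pt n)))) ∉
        directrixSpace (tangentConeIdeal (τ ∘ y) (span_range_comp_eq_maximalIdeal hy τ hτ)) := by
    intro n
    induction n with
    | zero => exact ⟨R, inferInstance, inferInstance, c, σ, h, hc, hσ, hd, hker, hm, hm', htrans0⟩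
    | succ n ih =>
      obtain ⟨R', i1, i2, y, τ, g, hy, hτ, hd', hkerτ, hgm, hgm', htr⟩ := ih
      obtain ⟨R'', j1, j2, y', τ', g', hy', hτ', hd'', hker', hgm2, hgm3, -, -, htr'⟩ :=
        exists_presentation_step_of_eq (T.isBlowup n) (pt (n + 1)) (pt n) (hπ n)
          (EmbeddedStep.stalkIdeal_centreIdeal_eq_maximalIdeal T pt n (hC n) (hcl n)) (hcl n) (hblow n) hd' y hy τ hτ hkerτ
          hm2 hgm hgm' j₀ (he1 n) (hon n) (hHS n) (by rw [he1 (n + 1)]) htr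
      exact ⟨R'', j1, j2, y', τ', g', hy', hτ', hd'', hker', hgm2, hgm3, htr'⟩
  -- every step is NOT a satellite step: two consecutive applications of the step
  have hnsat : ∀ n, ¬ IsSatelliteStep T pt n := by
    intro n
    obtain ⟨R', i1, i2, y, τ, g, hy, hτ, hd', hkerτ, hgm, hgm', htr⟩ := P n
    obtain ⟨R'', j1, j2, y', τ', g', hy', hτ', hd'', hker', hgm2, hgm3, hlink, hE, htr'⟩ :=
      exists_presentation_step_of_eq (T.isBlowup n) (pt (n + 1)) (pt n) (hπ n)
        (EmbeddedStep.stalkIdeal_centreIdeal_eq_maximalIdeal T pt n (hC n) (hcl n)) (hcl n) (hblow n) hd' y hy τ hτ hkerτ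
        hm2 hgm hgm' j₀ (he1 n) (hon n) (hHS n) (by rw [he1 (n + 1)]) htr
    obtain ⟨-, -, -, -, -, -, -, -, -, -, -, -, -, hE', -⟩ :=
      exists_presentation_step_of_eq (T.isBlowup (n + 1)) (pt (n + 2)) (pt (n + 1)) (hπ (n + 1))
        (EmbeddedStep.stalkIdeal_centreIdeal_eq_maximalIdeal T pt (n + 1) (hC (n + 1)) (hcl (n + 1))) (hcl (n + 1)) (hblow (n + 1))
        hd'' y' hy' τ' hτ' hker' hm2 hgm2 hgm3 j₀ (he1 (n + 1)) (hon (n + 1)) (hHS (n + 1)) (by rw [he1 (n + 2)]) htr'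
    have hc' : Ideal.span (Set.range (τ' ∘ y')) = maximalIdeal ((T.X (n + 1)).presheaf.stalk (pt (n + 1))) :=
      span_range_comp_eq_maximalIdeal hy' τ' hτ'
    refine (EmbeddedStep.not_isSatelliteStep_iff_forall_dvd_of_eq T pt n (hπ (n + 1)) hE hc').mpr fun k => ?_
    rw [Function.comp_apply, ← hlink]
    have hk : ((T.X (n + 1)).presheaf.stalkCongr (.of_eq (hπ (n + 1)))).inv ((τ' ∘ y') k) ∈
        maximalIdeal ((T.X (n + 1)).presheaf.stalk ((T.π (n + 1)) (pt (n + 2)))) :=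
      stalkCongr_inv_mem_maximalIdeal (hπ (n + 1)) (hc'.le (Ideal.subset_span ⟨k, rfl⟩))
    have hk' := Ideal.mem_map_of_mem ((T.π (n + 1)).stalkMap (pt (n + 2))).hom hk
    rw [hE'] at hk'
    exact Ideal.mem_span_singleton.mp hk'
  -- every step is RATIONAL
  have hrat : ∀ n, IsRationalStep T pt n := by
    intro n
    have hclπ : IsClosed ({(T.π n) (pt (n + 1))} : Set (T.X n)) := by rw [hπ n]; exact hcl n
    have hblowπ : IsBlowup (T.π n) (vanishingIdeal ⟨{(T.π n) (pt (n + 1))}, hclπ⟩) := by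
      have heq : (⟨{(T.π n) (pt (n + 1))}, hclπ⟩ : Closeds (T.X n)) = ⟨{pt n}, hcl n⟩ := by
        congr 1; rw [hπ n]
      rw [heq]; exact hblow n
    have heπ : Scheme.dirDim (T.X n) ((T.π n) (pt (n + 1))) = 1 := by rw [hπ n]; exact he1 n
    exact residueField_map_surjective_of_isOnProjDirectrix (pt (n + 1)) hclπ hblowπ heπ (hon n)
  -- (FREE)₀ in the slot-`0` indexing, then the grade-free H∞-FINAL
  obtain ⟨-, -, -, -, -, -, -, -, -, -, -, -, -, hE0, -⟩ :=
    exists_presentation_step_of_eq (T.isBlowup 0) (pt (0 + 1)) (pt 0) (hπ 0)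
      (EmbeddedStep.stalkIdeal_centreIdeal_eq_maximalIdeal T pt 0 (hC 0) (hcl 0)) (hcl 0) (hblow 0) hd c hc σ hσ hker
      hm2 hm hm' j₀ (he1 0) (hon 0) (hHS 0) (by rw [he1 (0 + 1)]) htrans0
  set x : Fin 4 → R := c ∘ Equiv.swap 0 j₀ with hxdef
  have hx : Ideal.span (Set.range x) = maximalIdeal R := by
    rw [hxdef, Set.range_comp, (Equiv.swap 0 j₀).surjective.range_eq, Set.image_univ, hc]
  have hx0 : x 0 = c j₀ := by rw [hxdef, Function.comp_apply, Equiv.swap_apply_left]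
  have hfree : ∀ k, ((T.π 0).stalkMap (pt (0 + 1))).hom (((T.X 0).presheaf.stalkCongr (.of_eq (hπ 0))).inv (σ (x 0))) ∣
      ((T.π 0).stalkMap (pt (0 + 1))).hom (((T.X 0).presheaf.stalkCongr (.of_eq (hπ 0))).inv (σ (x k))) := by
    intro k
    rw [hx0]
    have hk : ((T.X 0).presheaf.stalkCongr (.of_eq (hπ 0))).inv (σ (x k)) ∈
        maximalIdeal ((T.X 0).presheaf.stalk ((T.π 0) (pt 1))) :=
      stalkCongr_inv_mem_maximalIdeal (hπ 0) (hxA.le (Ideal.subset_span ⟨Equiv.swap 0 j₀ k, rfl⟩))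
    have hk' := Ideal.mem_map_of_mem ((T.π 0).stalkMap (pt 1)).hom hk
    rw [hE0] at hk'
    exact Ideal.mem_span_singleton.mp hk'
  exact IsoTailsHS.false_of_pointTower_of_freeRationalTail_of_hypersurfaceStage hC hπ hcl hν
    (fun n => le_trans (he1 n).ge (Scheme.dirDim_le_geomDirDim (pt n))) h0 0 hiso
    (fun n _ => ⟨hrat n, hnsat n⟩) hd x hx σ hσ hker hm hm' hfree

end Summit.ResolutionOfSingularities.ResolutionOfSingularities.Theorems.SigmaMaxModificationsCorridor3.E1Free

end
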